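import Summits.QuantumFields.YangMills.Theorems.F4SubCurvatureDoorBigOBudgetSharpnessRP
import Mathlib
import HarnessLib

/-!
# «BIG-O BUDGET SHARPNESS» for crux ⟨stmt-QuantumFields-23035⟩ — the owner's normalisation `WitnessLaplaceFourier`

Free-hands work of width seat `ym-line-sfw-p2-w4` (g24, cell `ym-idea-1`): the last sub-target Prop of the owner's file
`Cruxes/ShortRootRigidity/BigOBudgetSharpnessTarget.lean` (ym-idea-3 g21), restated character-for-character and PROVED:

  `K(t, z⃗) = (1/(1280π)) ∫_{ℝ³} W(p) e^{−|t|‖p‖} cos⟪p,z⃗⟫ ‖p‖⁻¹ dp`   (`t ≠ 0`, `W(p) = Σ_{j≠k} pⱼ⁴pₖ² + 2p₀²p₁²p₂²`),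

from `bigOWitness_eq_integral` (`…BigOBudgetSharpnessRP`: `K(y) = (π⁷/5)∫ e^{−2πy₀|w|}|w|⁻¹e^{−2πi⟪w,y⃗⟫}W(w) dw` for `y₀ > 0`) by evenness in
the time coordinate (`y₀ = |t|`), taking real parts, and the substitution `p = 2πw` (`MeasureTheory.Measure.integral_comp_smul`;
`(π⁷/5)·(2π)⁻³·(2π)·(2π)⁻⁶ = 1/(1280π)`).  With this, EVERY Prop of the owner's target file is a tree theorem.
HONEST LABEL: a sharpness statement about the HYPOTHESES of an OPEN crux; nothing of ⟨23035⟩, R2d or the YM mass gap is proved;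
`--supports stmt-QuantumFields-23035`.
-/

set_option autoImplicit false

noncomputable section

namespace Summit.QuantumFields.YangMills.Cruxes.ShortRootRigidity.Sharpness

open MeasureTheory Set Filter Complex
open scoped Topology RealInnerProductSpace BigOperators

/-! ## The registered text (verbatim from the target file) -/

/-- The Laplace–Fourier representation that carries `WitnessReflectionPositive` (verbatim sub-target; `W ≥ 0` termwise).
[problem-side target] -/
def WitnessLaplaceFourier : Prop :=
  ∀ (t : ℝ) (z : EuclideanSpace ℝ (Fin 3)), t ≠ 0 →
    bigOWitness ((WithLp.equiv 2 (Fin 4 → ℝ)).symm (Fin.cons t (fun j => z j)))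
      = (1 / (1280 * Real.pi)) * ∫ p : EuclideanSpace ℝ (Fin 3),
          ((∑ j : Fin 3, ∑ k : Fin 3, if j ≠ k then (p j) ^ 4 * (p k) ^ 2 else 0) + 2 * ((p 0) ^ 2 * (p 1) ^ 2 * (p 2) ^ 2))
            * Real.exp (-(|t| * ‖p‖)) * Real.cos (inner ℝ p z) * ‖p‖⁻¹

/-! ## The point `(t, z⃗)` of `ℝ⁴` -/

/-- Time coordinate of `(t, z⃗)`. [folklore] -/
theorem timeSpace_apply_zero (t : ℝ) (z : EuclideanSpace ℝ (Fin 3)) :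
    ((WithLp.equiv 2 (Fin 4 → ℝ)).symm (Fin.cons t (fun j => z j)) : E4) 0 = t := by
  simp

/-- Spatial coordinates of `(t, z⃗)`. [folklore] -/
theorem timeSpace_apply_succ (t : ℝ) (z : EuclideanSpace ℝ (Fin 3)) (k : Fin 3) :
    ((WithLp.equiv 2 (Fin 4 → ℝ)).symm (Fin.cons t (fun j => z j)) : E4) k.succ = z k := by
  simp

/-- The spatial part of `(t, z⃗)` is `z⃗`. [folklore] -/
theorem spacePart_timeSpace (t : ℝ) (z : EuclideanSpace ℝ (Fin 3)) :
    (WithLp.equiv 2 (Fin 3 → ℝ)).symm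
        (fun k : Fin 3 => ((WithLp.equiv 2 (Fin 4 → ℝ)).symm (Fin.cons t (fun j => z j)) : E4) k.succ) = z := by
  ext k
  simp

/-- `K(t, z⃗) = K(|t|, z⃗)` (the witness is even in the time coordinate). [folklore] -/
theorem bigOWitness_timeSpace_abs (t : ℝ) (z : EuclideanSpace ℝ (Fin 3)) :
    bigOWitness ((WithLp.equiv 2 (Fin 4 → ℝ)).symm (Fin.cons t (fun j => z j))) =
      bigOWitness ((WithLp.equiv 2 (Fin 4 → ℝ)).symm (Fin.cons |t| (fun j => z j))) := by
  rw [bigOWitness, bigOWitness, h6three_expand, h6three_expand, rootSextic_expand, rootSextic_expand,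
    show ‖((WithLp.equiv 2 (Fin 4 → ℝ)).symm (Fin.cons t (fun j => z j)) : E4)‖ ^ 14 =
      (‖((WithLp.equiv 2 (Fin 4 → ℝ)).symm (Fin.cons t (fun j => z j)) : E4)‖ ^ 2) ^ 7 by ring,
    show ‖((WithLp.equiv 2 (Fin 4 → ℝ)).symm (Fin.cons |t| (fun j => z j)) : E4)‖ ^ 14 =
      (‖((WithLp.equiv 2 (Fin 4 → ℝ)).symm (Fin.cons |t| (fun j => z j)) : E4)‖ ^ 2) ^ 7 by ring,
    norm_sq_E4, norm_sq_E4,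
    show (1 : Fin 4) = (0 : Fin 3).succ from rfl, show (2 : Fin 4) = (1 : Fin 3).succ from rfl,
    show (3 : Fin 4) = (2 : Fin 3).succ from rfl]
  simp only [timeSpace_apply_zero, timeSpace_apply_succ]
  rw [show |t| ^ 2 = t ^ 2 from sq_abs t, show |t| ^ 6 = t ^ 6 by rw [show (6 : ℕ) = 2 * 3 from rfl, pow_mul, pow_mul, sq_abs],
    show |t| ^ 4 = t ^ 4 by rw [show (4 : ℕ) = 2 * 2 from rfl, pow_mul, pow_mul, sq_abs]]

/-! ## The owner's normalisation -/

/-- ★ **`WitnessLaplaceFourier`** (the owner's normalisation): for `t ≠ 0`,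
`K(t, z⃗) = (1/(1280π)) ∫ W(p) e^{−|t|‖p‖} cos⟪p,z⃗⟫ ‖p‖⁻¹ dp`. -/
theorem witnessLaplaceFourier : WitnessLaplaceFourier := by
  intro t z ht
  have hta : 0 < |t| := abs_pos.2 ht
  rw [bigOWitness_timeSpace_abs]
  -- the representation at `y = (|t|, z⃗)`
  have hrep := bigOWitness_eq_integral ((WithLp.equiv 2 (Fin 4 → ℝ)).symm (Fin.cons |t| (fun j => z j)))
    (by rw [timeSpace_apply_zero]; exact hta)
  rw [spacePart_timeSpace, timeSpace_apply_zero] at hrep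
  have hint := integrable_yukawaPhase_mul_weight hta z
  -- real parts
  have hre : bigOWitness ((WithLp.equiv 2 (Fin 4 → ℝ)).symm (Fin.cons |t| (fun j => z j))) =
      Real.pi ^ 7 / 5 * ∫ (w : EuclideanSpace ℝ (Fin 3)), Real.exp (-(2 * Real.pi * |t| * ‖w‖)) / ‖w‖ *
        Real.cos (-2 * Real.pi * ⟪w, z⟫) *
        (w 0 ^ 4 * w 1 ^ 2 + w 0 ^ 4 * w 2 ^ 2 + w 1 ^ 4 * w 0 ^ 2 + w 1 ^ 4 * w 2 ^ 2 + w 2 ^ 4 * w 0 ^ 2 + w 2 ^ 4 * w 1 ^ 2 +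
          2 * (w 0 ^ 2 * w 1 ^ 2 * w 2 ^ 2)) := by
    have h := congrArg Complex.re hrep
    rw [Complex.ofReal_re, Complex.re_ofReal_mul, ← Complex.reCLM_apply (∫ (w : EuclideanSpace ℝ (Fin 3)), _),
      ← Complex.reCLM.integral_comp_comm hint] at h
    rw [h]
    congr 1
    refine integral_congr_ae (Eventually.of_forall fun w => ?_)
    simp only [Complex.reCLM_apply]
    rw [show ((Real.exp (-(2 * Real.pi * |t| * ‖w‖)) / ‖w‖ : ℝ) : ℂ) * cexp (↑(-2 * Real.pi * ⟪w, z⟫) * I) *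
        (((w 0 ^ 4 * w 1 ^ 2 + w 0 ^ 4 * w 2 ^ 2 + w 1 ^ 4 * w 0 ^ 2 + w 1 ^ 4 * w 2 ^ 2 + w 2 ^ 4 * w 0 ^ 2 + w 2 ^ 4 * w 1 ^ 2 +
          2 * (w 0 ^ 2 * w 1 ^ 2 * w 2 ^ 2) : ℝ)) : ℂ) =
        (((Real.exp (-(2 * Real.pi * |t| * ‖w‖)) / ‖w‖ *
          (w 0 ^ 4 * w 1 ^ 2 + w 0 ^ 4 * w 2 ^ 2 + w 1 ^ 4 * w 0 ^ 2 + w 1 ^ 4 * w 2 ^ 2 + w 2 ^ 4 * w 0 ^ 2 + w 2 ^ 4 * w 1 ^ 2 +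
            2 * (w 0 ^ 2 * w 1 ^ 2 * w 2 ^ 2))) : ℝ) : ℂ) * cexp (↑(-2 * Real.pi * ⟪w, z⟫) * I) by push_cast; ring,
      Complex.re_ofReal_mul, Complex.exp_ofReal_mul_I_re]
    ring
  rw [hre]
  -- the substitution `p = 2πw`
  have h2π : (0 : ℝ) < 2 * Real.pi := Real.two_pi_pos
  have hsub : (fun w : EuclideanSpace ℝ (Fin 3) => Real.exp (-(2 * Real.pi * |t| * ‖w‖)) / ‖w‖ *
        Real.cos (-2 * Real.pi * ⟪w, z⟫) *
        (w 0 ^ 4 * w 1 ^ 2 + w 0 ^ 4 * w 2 ^ 2 + w 1 ^ 4 * w 0 ^ 2 + w 1 ^ 4 * w 2 ^ 2 + w 2 ^ 4 * w 0 ^ 2 + w 2 ^ 4 * w 1 ^ 2 +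
          2 * (w 0 ^ 2 * w 1 ^ 2 * w 2 ^ 2))) =
      fun w : EuclideanSpace ℝ (Fin 3) => (fun p : EuclideanSpace ℝ (Fin 3) => ((2 * Real.pi) ^ 5)⁻¹ *
        (((∑ j : Fin 3, ∑ k : Fin 3, if j ≠ k then (p j) ^ 4 * (p k) ^ 2 else 0) + 2 * ((p 0) ^ 2 * (p 1) ^ 2 * (p 2) ^ 2))
          * Real.exp (-(|t| * ‖p‖)) * Real.cos (inner ℝ p z) * ‖p‖⁻¹)) ((2 * Real.pi) • w) := by
    funext w
    simp only [Fin.sum_univ_three, Fin.isValue, ne_eq, Fin.reduceEq, not_true_eq_false, if_false, not_false_eq_true,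
      if_true, PiLp.smul_apply, smul_eq_mul, norm_smul, real_inner_smul_left, Real.norm_eq_abs, abs_of_pos h2π]
    rw [show -2 * Real.pi * ⟪w, z⟫ = -(2 * Real.pi * ⟪w, z⟫) by ring, Real.cos_neg]
    by_cases hw : ‖w‖ = 0
    · rw [hw]; simp
    · field_simp
      ring
  have hcs := Measure.integral_comp_smul (volume : Measure (EuclideanSpace ℝ (Fin 3)))
    (fun p : EuclideanSpace ℝ (Fin 3) => ((2 * Real.pi) ^ 5)⁻¹ *
      (((∑ j : Fin 3, ∑ k : Fin 3, if j ≠ k then (p j) ^ 4 * (p k) ^ 2 else 0) + 2 * ((p 0) ^ 2 * (p 1) ^ 2 * (p 2) ^ 2))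
        * Real.exp (-(|t| * ‖p‖)) * Real.cos (inner ℝ p z) * ‖p‖⁻¹)) (2 * Real.pi)
  rw [hsub, hcs, finrank_euclideanSpace_fin, integral_const_mul, smul_eq_mul, abs_of_pos (inv_pos.2 (pow_pos h2π 3))]
  have hπ : Real.pi ≠ 0 := Real.pi_pos.ne'
  field_simp
  ring

end Summit.QuantumFields.YangMills.Cruxes.ShortRootRigidity.Sharpness

end
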